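import Summits.CriticalPhenomena.PercolationContinuityZ3.Theorems.PercNearOneGluingNoHeavyPcintMeanBondCoin
import Summits.CriticalPhenomena.PercolationContinuityZ3.Theorems.PercNearOneGluingNoHeavyPcintChainBondReduction
import HarnessLib

/-!
# PCINT lane, reduction B3m (`chordmean_cw`): `θ(p) ≤ Σ_{γ ∈ SAW_n} meanBondWeight p s t t' kc γ`

Cell `prim-pcint` (PAPER-2 track (iii): certified intervals for `p_c(ℤ^d)`), seat `prim-pcint-2` (gen 4); support file
(`--supports stmt-CriticalPhenomena-4575`).  Does NOT build on p205010.  Memo: `run/shared/lean/prim/pcint/REDUCTIONS.md` §B3m.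

The same geodesic event `chainEvent o γ` as B3c/B3t, bounded site by site with three units (`real_siteEvt_le_pow3` of
`…MeanBondUnits`), now with TWO families of order-dependent factors: the genuine corner coins (`s² ‖ 1` per corner step) and
the corner-third coins (`t ‖ t'` per corner-third step, `c3StepsNat`: the steps `incAt w (k-1)` of the corner-third units
`(w, k)`, indexed injectively because the unit records `cornerSite γ (incAt (k-1)) = w`).  The two families live on disjoint
steps with perpendicular step pairs, so `sum_orders_prod_coin2` (`…MeanBondCoin`) averages them:
`θ(p) ≤ Σ_{γ ∈ SAW_n} pⁿ (1-p)^{#chords} s^{s3Total} t^{tTotal} ((t+t')/2)^{c3Total} ((1+s²)/2)^{cornerTotal}`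
(**`theta_le_sum_meanBondWeight`**), glue `le_criticalProb_zd_of_meanBond_le_geometric`.
-/

noncomputable section

namespace Summit.CriticalPhenomena.PercolationContinuityZ3.Theorems.Pcint

open Finset MeasureTheory Literature.Probability.Percolation Literature.Probability.LatticeModels

variable {d n : ℕ}

namespace ChainBond

/-! ### The corner-third steps of a word -/

/-- The corner-third steps of the site `w`: `incAt w (k-1)` for its corner-third units `k`. [folklore] -/
def c3StepsOf (kc : ℕ) (γ : Fin n → Fin d × Bool) (w : Site d) : Finset ℕ :=
  (c3Set kc γ w).image fun k => incAt γ w (k - 1)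

/-- The indexing of corner-third steps by units is injective at a site. [folklore] -/
theorem c3StepsOf_injOn (kc : ℕ) (γ : Fin n → Fin d × Bool) (w : Site d) :
    Set.InjOn (fun k => incAt γ w (k - 1)) ↑(c3Set kc γ w) := by
  intro k hk k' hk' h
  obtain ⟨⟨_, hkr, -, -⟩, hk2, -⟩ := mem_c3Set.1 (mem_coe.1 hk)
  obtain ⟨⟨_, hk'r, -, -⟩, hk'2, -⟩ := mem_c3Set.1 (mem_coe.1 hk')
  have := incAt_inj (by omega) (by omega) h
  omega

/-- What a corner-third step records. [folklore] -/
theorem mem_c3StepsOf {kc : ℕ} {γ : Fin n → Fin d × Bool} {w : Site d} {s : ℕ} (hs : s ∈ c3StepsOf kc γ w) :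
    ∃ k, k ∈ c3Set kc γ w ∧ incAt γ w (k - 1) = s ∧ s + 2 ≤ n ∧ cornerSite γ s = w ∧ StepsPerp γ s ∧
      (zdGraph d).Adj (wordPos γ (incAt γ w 0)) w ∧ incAt γ w 0 < s := by
  obtain ⟨k, hk, rfl⟩ := mem_image.1 hs
  obtain ⟨⟨_, hkr, -, -⟩, hk2, hgap, hC, hperp⟩ := mem_c3Set.1 hk
  have hkn := (mem_incTimes.1 (incAt_mem hkr)).1
  refine ⟨k, hk, rfl, by omega, hC, hperp, (mem_incTimes.1 (incAt_mem (by omega : 0 < (incTimes γ w).card))).2,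
    incAt_strictMono (by omega) (by omega)⟩

/-- The corner-third steps of a word. [folklore] -/
def c3StepsNat (kc : ℕ) (γ : Fin n → Fin d × Bool) : Finset ℕ := (offSites γ).biUnion (c3StepsOf kc γ)

/-- Corner-third steps of different sites are different. [folklore] -/
theorem c3StepsOf_disjoint (kc : ℕ) (γ : Fin n → Fin d × Bool) {w w' : Site d} (h : w ≠ w') :
    Disjoint (c3StepsOf kc γ w) (c3StepsOf kc γ w') := by
  rw [disjoint_left]
  intro s hs hs'
  obtain ⟨-, -, -, -, hC, -⟩ := mem_c3StepsOf hs
  obtain ⟨-, -, -, -, hC', -⟩ := mem_c3StepsOf hs'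
  exact h (hC.symm.trans hC')

/-- **The corner-third steps number `c3Total`.** [folklore] -/
theorem card_c3StepsNat (kc : ℕ) (γ : Fin n → Fin d × Bool) : (c3StepsNat kc γ).card = c3Total kc γ := by
  rw [c3StepsNat, card_biUnion fun w _ w' _ h => c3StepsOf_disjoint kc γ h, c3Total]
  exact sum_congr rfl fun w _ => card_image_of_injOn (c3StepsOf_injOn kc γ w)

/-- A corner-third step is not a genuine corner (the site has an older incidence). [folklore] -/
theorem not_isCorner_of_mem_c3StepsNat {kc : ℕ} {γ : Fin n → Fin d × Bool} {s : ℕ} (hs : s ∈ c3StepsNat kc γ) :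
    ¬ IsCorner γ s := by
  obtain ⟨w, -, hsw⟩ := mem_biUnion.1 hs
  obtain ⟨-, -, -, -, hC, -, hadj0, hlt⟩ := mem_c3StepsOf hsw
  rintro ⟨-, -, -, hno⟩
  exact hno (incAt γ w 0) (mem_range.2 hlt) (by rw [hC]; exact hadj0)

/-! ### The coin factors of a world, regrouped by steps -/

open Classical in
/-- The corner-third factors of a site as a product over its units. [folklore] -/
theorem pow_c3_eq_prod (o : Orders d n) (kc : ℕ) (γ : Fin n → Fin d × Bool) (w : Site d) (t t' : ℝ) :
    t ^ (c3bad o kc γ w).card * t' ^ (c3good o kc γ w).card =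
      ∏ k ∈ c3Set kc γ w, (if IsBad o γ (incAt γ w (k - 1)) then t else t') := by
  rw [← prod_filter_mul_prod_filter_not (c3Set kc γ w) (fun k => IsBad o γ (incAt γ w (k - 1))),
    prod_congr rfl fun k hk => if_pos (mem_filter.1 hk).2, prod_congr rfl fun k hk => if_neg (mem_filter.1 hk).2,
    prod_const, prod_const]
  rfl

open Classical in
/-- **The order-dependent factors of a world as one product over steps.** [folklore] -/
theorem coinFactors_eq_prod (o : Orders d n) (kc : ℕ) (γ : Fin n → Fin d × Bool) (s2 t t' : ℝ) :
    s2 ^ (badTimes o γ).card * ∏ w ∈ offSites γ, (t ^ (c3bad o kc γ w).card * t' ^ (c3good o kc γ w).card) =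
      (∏ s ∈ cornerTimes γ, (if IsBad o γ s then s2 else 1)) *
        ∏ s ∈ c3StepsNat kc γ, (if IsBad o γ s then t else t') := by
  congr 1
  · rw [← prod_cornerFactor_eq s2 o γ]
    exact prod_congr rfl fun s _ => cornerFactor_eq_ite s2 o γ s
  · rw [c3StepsNat, prod_biUnion fun w _ w' _ h => c3StepsOf_disjoint kc γ h]
    refine prod_congr rfl fun w _ => ?_
    rw [pow_c3_eq_prod, c3StepsOf, prod_image (c3StepsOf_injOn kc γ w)]

/-- The corner-third steps as a set of `Fin n`. [folklore] -/
def CS3 (kc : ℕ) (γ : Fin n → Fin d × Bool) : Finset (Fin n) := univ.filter fun s => (s : ℕ) ∈ c3StepsNat kc γ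

/-- Products over `CS3` are products over `c3StepsNat`. [folklore] -/
theorem prod_CS3 (kc : ℕ) (γ : Fin n → Fin d × Bool) (f : ℕ → ℝ) :
    ∏ s ∈ CS3 kc γ, f s = ∏ s ∈ c3StepsNat kc γ, f s := by
  refine prod_nbij (fun s => (s : ℕ)) (fun s hs => mem_coe.2 (mem_filter.1 (mem_coe.1 hs)).2)
    (fun s _ s' _ h => Fin.ext h) (fun s hs => ?_) (fun _ _ => rfl)
  have hs' := mem_coe.1 hs
  obtain ⟨w, -, hsw⟩ := mem_biUnion.1 hs'
  obtain ⟨-, -, -, hsn, -⟩ := mem_c3StepsOf hsw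
  exact ⟨⟨s, by omega⟩, mem_coe.2 (mem_filter.2 ⟨mem_univ _, hs'⟩), rfl⟩

/-- `#CS3 = c3Total`. [folklore] -/
theorem card_CS3 (kc : ℕ) (γ : Fin n → Fin d × Bool) : (CS3 kc γ).card = c3Total kc γ := by
  rw [← card_c3StepsNat]
  refine card_nbij (fun s => (s : ℕ)) (fun s hs => mem_coe.2 (mem_filter.1 (mem_coe.1 hs)).2)
    (fun s _ s' _ h => Fin.ext h) (fun s hs => ?_)
  have hs' := mem_coe.1 hs
  obtain ⟨w, -, hsw⟩ := mem_biUnion.1 hs'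
  obtain ⟨-, -, -, hsn, -⟩ := mem_c3StepsOf hsw
  exact ⟨⟨s, by omega⟩, mem_coe.2 (mem_filter.2 ⟨mem_univ _, hs'⟩), rfl⟩

open Classical in
/-- **Averaging the two coin families.** [folklore] -/
theorem sum_orders_coinFactors (kc : ℕ) (γ : Fin n → Fin d × Bool) (s2 t t' : ℝ) :
    ∑ o : Orders d n, s2 ^ (badTimes o γ).card * ∏ w ∈ offSites γ, (t ^ (c3bad o kc γ w).card * t' ^ (c3good o kc γ w).card) =
      Fintype.card (Orders d n) * (((1 + s2) / 2) ^ cornerTotal γ * ((t + t') / 2) ^ c3Total kc γ) := by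
  set x : Fin n → ℝ := fun s => if s ∈ cornerTimes γ then s2 else t with hx
  set y : Fin n → ℝ := fun s => if s ∈ cornerTimes γ then 1 else t' with hy
  have hdisj : Disjoint (cornerTimes γ) (CS3 kc γ) := by
    rw [disjoint_left]
    intro s hs hs3
    exact not_isCorner_of_mem_c3StepsNat (mem_filter.1 hs3).2 (mem_cornerTimes.1 hs)
  have hperp : ∀ s ∈ cornerTimes γ ∪ CS3 kc γ, StepsPerp γ s := by
    intro s hs
    rcases mem_union.1 hs with hs | hs
    · obtain ⟨h, hperp, -, -⟩ := mem_cornerTimes.1 hs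
      exact ⟨h, hperp⟩
    · obtain ⟨w, -, hsw⟩ := mem_biUnion.1 (mem_filter.1 hs).2
      obtain ⟨-, -, -, -, -, hp, -⟩ := mem_c3StepsOf hsw
      exact hp
  have key := sum_orders_prod_coin2 x y γ (cornerTimes γ ∪ CS3 kc γ) hperp
  have hsplit : ∀ o : Orders d n, ∏ s ∈ cornerTimes γ ∪ CS3 kc γ, (if IsBad o γ s then x s else y s) =
      s2 ^ (badTimes o γ).card * ∏ w ∈ offSites γ, (t ^ (c3bad o kc γ w).card * t' ^ (c3good o kc γ w).card) := by
    intro o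
    rw [prod_union hdisj, coinFactors_eq_prod, ← prod_CS3]
    congr 1
    · exact prod_congr rfl fun s hs => by simp only [hx, hy, if_pos hs]
    · exact prod_congr rfl fun s hs => by
        have hns : s ∉ cornerTimes γ := fun h => disjoint_left.1 hdisj h hs
        simp only [hx, hy, if_neg hns]
  have hmean : ∏ s ∈ cornerTimes γ ∪ CS3 kc γ, ((x s + y s) / 2) = ((1 + s2) / 2) ^ cornerTotal γ * ((t + t') / 2) ^ c3Total kc γ := by
    rw [prod_union hdisj, cornerTotal, ← card_CS3 kc γ, ← prod_const, ← prod_const]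
    congr 1
    · exact prod_congr rfl fun s hs => by simp only [hx, hy, if_pos hs]; ring
    · exact prod_congr rfl fun s hs => by
        have hns : s ∉ cornerTimes γ := fun h => disjoint_left.1 hdisj h hs
        simp only [hx, hy, if_neg hns]
  simp_rw [hsplit] at key
  rw [key, hmean]

/-! ### The reduction -/

/-- **The probability of the geodesic event, B3m bookkeeping.** [folklore] -/
theorem real_meanEvent_le (p : unitInterval) {s t t' : ℝ} (hps : 1 - (p : ℝ) ^ 2 ≤ s ^ 2) (hs1 : s ≤ 1) (ht0 : 0 ≤ t)
    (htt : t ≤ t') (hts : t' ≤ s) (htp : (1 - (p : ℝ)) * (1 + 2 * p) ≤ t * (1 + p))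
    (hgap : (p : ℝ) ^ 2 ≤ (t' - t) * (1 + p)) {kc : ℕ} (hkc : 2 ≤ kc) (o : Orders d n) {γ : Fin n → Fin d × Bool}
    (hsaw : IsSAW γ) :
    (bondPercolation (zdGraph d) p).real (chainEvent o γ) ≤
      (p : ℝ) ^ n * (1 - p : ℝ) ^ (chordEdges γ).card * s ^ s3Total kc γ * t ^ tTotal kc γ *
        ((s ^ 2) ^ (badTimes o γ).card * ∏ w ∈ offSites γ, (t ^ (c3bad o kc γ w).card * t' ^ (c3good o kc γ w).card)) := by
  classical
  set μ := bondPercolation (zdGraph d) p with hμ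
  have hbase := determinedBy_baseEvt γ
  have hsites : DeterminedBy (⋂ w ∈ offSites γ, siteEvt o γ w)
      (↑((offSites γ).biUnion (incEdges γ)) : Set (Sym2 (Site d))) :=
    DeterminedBy.biInter_finset fun w _ => determinedBy_siteEvt o γ w
  have hoff : ∀ w ∈ offSites γ, w ∉ pathSites γ := fun w hw => (mem_offSites.1 hw).1
  have hdisj : Disjoint (wordEdges γ ∪ chordEdges γ) ((offSites γ).biUnion (incEdges γ)) := by
    rw [disjoint_biUnion_right]
    exact fun w hw => disjoint_base_incEdges (hoff w hw)
  have hprob : μ.real (chainEvent o γ) = μ.real (baseEvt γ) * ∏ w ∈ offSites γ, μ.real (siteEvt o γ w) := by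
    rw [chainEvent, hμ, bondPercolation_real_inter_of_disjoint (zdGraph d) p (disjoint_coe.2 hdisj) hbase hsites
        hbase.measurableSet_of_finset hsites.measurableSet_of_finset,
      bondPercolation_real_biInter_eq_prod p (offSites γ) (siteEvt o γ) (incEdges γ)
        (fun w _ => determinedBy_siteEvt o γ w) (fun w hw w' _ hne => incEdges_disjoint hsaw (hoff w hw) hne)]
  have hbaseP : μ.real (baseEvt γ) = (p : ℝ) ^ n * (1 - p : ℝ) ^ (chordEdges γ).card := by
    rw [hμ, baseEvt, bondPercolation_real_open_closed _ _ (wordEdges_subset_edgeSet γ) (chordEdges_subset_edgeSet γ)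
      (IsSAW.disjoint_wordEdges_chordEdges hsaw), hsaw.card_wordEdges]
  have hsiteP : ∏ w ∈ offSites γ, μ.real (siteEvt o γ w) ≤
      ∏ w ∈ offSites γ, (s ^ (s3Units kc γ w + 2 * (badFiber o γ w).card) * t ^ (tUnits kc γ w + (c3bad o kc γ w).card) *
        t' ^ (c3good o kc γ w).card) :=
    prod_le_prod (fun w _ => measureReal_nonneg) fun w hw => by
      rw [hμ]; exact real_siteEvt_le_pow3 p hps hs1 ht0 htt hts htp hgap hkc hsaw (hoff w hw)
  have hexp : ∏ w ∈ offSites γ, (s ^ (s3Units kc γ w + 2 * (badFiber o γ w).card) *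
      t ^ (tUnits kc γ w + (c3bad o kc γ w).card) * t' ^ (c3good o kc γ w).card) =
      s ^ s3Total kc γ * t ^ tTotal kc γ *
        ((s ^ 2) ^ (badTimes o γ).card * ∏ w ∈ offSites γ, (t ^ (c3bad o kc γ w).card * t' ^ (c3good o kc γ w).card)) := by
    have e1 : ∀ w, s ^ (s3Units kc γ w + 2 * (badFiber o γ w).card) * t ^ (tUnits kc γ w + (c3bad o kc γ w).card) *
        t' ^ (c3good o kc γ w).card = (s ^ s3Units kc γ w * t ^ tUnits kc γ w * (s ^ 2) ^ (badFiber o γ w).card) *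
          (t ^ (c3bad o kc γ w).card * t' ^ (c3good o kc γ w).card) := fun w => by rw [pow_add, pow_add, pow_mul]; ring
    rw [prod_congr rfl fun w _ => e1 w, prod_mul_distrib, prod_mul_distrib, prod_mul_distrib, prod_pow_eq_pow_sum,
      prod_pow_eq_pow_sum, prod_pow_eq_pow_sum, sum_card_badFiber, s3Total, tTotal]
    ring
  rw [hprob, hbaseP]
  calc (p : ℝ) ^ n * (1 - p : ℝ) ^ (chordEdges γ).card * ∏ w ∈ offSites γ, μ.real (siteEvt o γ w)
      ≤ (p : ℝ) ^ n * (1 - p : ℝ) ^ (chordEdges γ).card * ∏ w ∈ offSites γ, (s ^ (s3Units kc γ w + 2 * (badFiber o γ w).card) *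
          t ^ (tUnits kc γ w + (c3bad o kc γ w).card) * t' ^ (c3good o kc γ w).card) :=
        mul_le_mul_of_nonneg_left hsiteP (mul_nonneg (pow_nonneg p.2.1 _) (pow_nonneg (sub_nonneg.2 p.2.2) _))
    _ = _ := by rw [hexp]; ring

/-- **Reduction B3m** (certificate kind `chordmean_cw`, full-information form). [folklore] -/
theorem theta_le_sum_meanBondWeight (d n : ℕ) (p : unitInterval) {s t t' : ℝ} (hps : 1 - (p : ℝ) ^ 2 ≤ s ^ 2) (hs1 : s ≤ 1)
    (ht0 : 0 ≤ t) (htt : t ≤ t') (hts : t' ≤ s) (htp : (1 - (p : ℝ)) * (1 + 2 * p) ≤ t * (1 + p))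
    (hgap : (p : ℝ) ^ 2 ≤ (t' - t) * (1 + p)) {kc : ℕ} (hkc : 2 ≤ kc) :
    theta (zdGraph d) 0 p ≤ ∑ γ ∈ sawWords d n, meanBondWeight p s t t' kc γ := by
  classical
  set bound : Orders d n → (Fin n → Fin d × Bool) → ℝ := fun o γ =>
    (p : ℝ) ^ n * (1 - p : ℝ) ^ (chordEdges γ).card * s ^ s3Total kc γ * t ^ tTotal kc γ *
      ((s ^ 2) ^ (badTimes o γ).card * ∏ w ∈ offSites γ, (t ^ (c3bad o kc γ w).card * t' ^ (c3good o kc γ w).card))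
    with hbound
  -- per family of orders
  have ho : ∀ o : Orders d n, theta (zdGraph d) 0 p ≤ ∑ γ ∈ sawWords d n, bound o γ := by
    intro o
    set μ := bondPercolation (zdGraph d) p with hμ
    set bad : Set (BondConfig (Site d)) := {ω | ¬ ω ⊆ (zdGraph d).edgeSet} with hbad
    have hbad0 : μ.real bad = 0 := by
      rw [measureReal_eq_zero_iff]
      have := ProbabilityTheory.setBernoulli_ae_subset (u := (zdGraph d).edgeSet) (p := p)
      rw [Filter.Eventually, mem_ae_iff, Set.compl_setOf] at this
      exact this
    calc theta (zdGraph d) 0 p = μ.real (percolatesAt 0) := rfl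
      _ ≤ μ.real ((⋃ γ ∈ sawWords d n, chainEvent o γ) ∪ bad) :=
          measureReal_mono (percolatesAt_subset_biUnion_chainEvent o)
      _ ≤ μ.real (⋃ γ ∈ sawWords d n, chainEvent o γ) + μ.real bad := measureReal_union_le _ _
      _ = μ.real (⋃ γ ∈ sawWords d n, chainEvent o γ) := by rw [hbad0, add_zero]
      _ ≤ ∑ γ ∈ sawWords d n, μ.real (chainEvent o γ) := measureReal_biUnion_finset_le _ _
      _ ≤ _ := sum_le_sum fun γ hγ => ?_
    rw [hμ]
    exact real_meanEvent_le p hps hs1 ht0 htt hts htp hgap hkc o (mem_sawWords.1 hγ)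
  have hO : (0 : ℝ) < Fintype.card (Orders d n) := Nat.cast_pos.2 Fintype.card_pos
  have hsum := sum_le_sum fun (o : Orders d n) (_ : o ∈ univ) => ho o
  rw [sum_const, card_univ, nsmul_eq_mul, sum_comm] at hsum
  have key : ∑ γ ∈ sawWords d n, ∑ o : Orders d n, bound o γ =
      Fintype.card (Orders d n) * ∑ γ ∈ sawWords d n, meanBondWeight p s t t' kc γ := by
    rw [mul_sum]
    refine sum_congr rfl fun γ _ => ?_
    rw [hbound]
    simp only []
    rw [← mul_sum, sum_orders_coinFactors, meanBondWeight]
    ring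
  rw [key] at hsum
  exact le_of_mul_le_mul_left hsum hO

/-! ### Certificate glue -/

/-- **Certificate glue (B3m).** If `Σ_{γ ∈ SAW_n} meanBondWeight p s t t' kc γ ≤ C rⁿ` for all `n` with `r < 1`,
then `θ(p) = 0`. [folklore] -/
theorem theta_zd_eq_zero_of_meanBond_le_geometric (d : ℕ) (p : unitInterval) {s t t' C r : ℝ}
    (hps : 1 - (p : ℝ) ^ 2 ≤ s ^ 2) (hs1 : s ≤ 1) (ht0 : 0 ≤ t) (htt : t ≤ t') (hts : t' ≤ s)
    (htp : (1 - (p : ℝ)) * (1 + 2 * p) ≤ t * (1 + p)) (hgap : (p : ℝ) ^ 2 ≤ (t' - t) * (1 + p)) {kc : ℕ} (hkc : 2 ≤ kc)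
    (hr0 : 0 ≤ r) (hr : r < 1) (h : ∀ n, ∑ γ ∈ sawWords d n, meanBondWeight p s t t' kc γ ≤ C * r ^ n) :
    theta (zdGraph d) 0 p = 0 := by
  have hlim : Filter.Tendsto (fun n : ℕ => C * r ^ n) Filter.atTop (nhds 0) := by
    simpa using (tendsto_pow_atTop_nhds_zero_of_lt_one hr0 hr).const_mul C
  exact le_antisymm (ge_of_tendsto' hlim fun n =>
    (theta_le_sum_meanBondWeight d n p hps hs1 ht0 htt hts htp hgap hkc).trans (h n)) measureReal_nonneg

/-- **Certificate glue (B3m), threshold form**: under the same hypothesis, `p ≤ p_c^bond(ℤ^d)`. [folklore] -/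
theorem le_criticalProb_zd_of_meanBond_le_geometric (d : ℕ) (p : unitInterval) {s t t' C r : ℝ}
    (hps : 1 - (p : ℝ) ^ 2 ≤ s ^ 2) (hs1 : s ≤ 1) (ht0 : 0 ≤ t) (htt : t ≤ t') (hts : t' ≤ s)
    (htp : (1 - (p : ℝ)) * (1 + 2 * p) ≤ t * (1 + p)) (hgap : (p : ℝ) ^ 2 ≤ (t' - t) * (1 + p)) {kc : ℕ} (hkc : 2 ≤ kc)
    (hr0 : 0 ≤ r) (hr : r < 1) (h : ∀ n, ∑ γ ∈ sawWords d n, meanBondWeight p s t t' kc γ ≤ C * r ^ n) :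
    (p : ℝ) ≤ criticalProb (zdGraph d) 0 := by
  have h0 := theta_zd_eq_zero_of_meanBond_le_geometric d p hps hs1 ht0 htt hts htp hgap hkc hr0 hr h
  refine le_csInf ⟨1, Or.inr rfl⟩ ?_
  rintro q (⟨hq, hpos⟩ | hq)
  · by_contra hlt
    push Not at hlt
    have hmono := theta_mono_holds (zdGraph d) (0 : Site d) (show (⟨q, hq⟩ : unitInterval) ≤ p from hlt.le)
    have : theta (zdGraph d) 0 ⟨q, hq⟩ ≤ 0 := hmono.trans_eq h0
    exact hpos.not_ge this
  · rw [Set.mem_singleton_iff] at hq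
    rw [hq]
    exact p.2.2

end ChainBond

end Summit.CriticalPhenomena.PercolationContinuityZ3.Theorems.Pcint
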